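import Mathlib
import HarnessLib
import HarnessLib.Audit
import Summits.SmoothPoincare4.Statement
import Literature.Geometry.Lorentzian.PseudoRiemannianMetric
import Literature.Geometry.Lorentzian.LeviCivita
import Literature.Geometry.Lorentzian.Isometry
import Literature.Geometry.Riemannian.IsotropicCurvature
import Literature.Geometry.Riemannian.CurvatureOperator
import Literature.Topology.FourManifolds.HomotopyS4CompactProofs
import HarnessLib.Audit.Status.Attr

/-!
Route: ExoticMirrors

DORMANT since 2026-08-22T15:44:38Z (reconciler: no traction for 5.5 d (last activity item-evidence-added at 2026-08-17T04:14:01Z); parked, not closed — `ledger route dormant route-SmoothPoincare4-ExoticMirrors --off` to reactivate) — unstaffed, not closed; items shared with open routes are served there. `ledger route dormant <id> --off` reactivates.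

# Route ExoticMirrors — fake 4-spheres are mirrors of S⁵ that repel nonnegative curvature

It suffices to show X = MIRROR-NONNEG: whenever a closed smooth 4-manifold M ≃ₕ S⁴ sits in the
standard S⁵ as the
fixed-point set of a smooth involution τ (a "mirror"; every homotopy 4-sphere does, by doubling a
contractible coboundary,
KervaireMilnorAnnals1963 + Smale1962, support MirrorRealisation), S⁵ carries a τ-INVARIANT
Riemannian metric of nonnegative
sectional curvature. Then the mirror is totally geodesic, the half S⁵/τ is a compact nonnegatively
curved 5-manifold with convex
boundary, the Cheeger–Gromoll soul construction makes S⁵ the double of a disc bundle over a soul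
(FangGrove2016, "core example"
and Theorem (Open Book), k = 1), topology of S⁵ forces the soul to be a point, and M ≅ S⁴ (crux
ReflectionSoulRigidity). Card
realised: exotic-mirror-s5-ricci-flow, at its sec ≥ 0 rung (the card's Böhm–Wilking / 2-positive
rung is dominated: see Why this line).
Lean: `∀ (τ : (Metric.sphere (0 : EuclideanSpace ℝ (Fin 6)) 1) ≃ₘ⟮𝓡 5, 𝓡 5⟯ (Metric.sphere (0 :
EuclideanSpace ℝ (Fin 6)) 1)), (∀ x, τ (τ x) = x) → ∀ (M : Type) [TopologicalSpace M] [T2Space M]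
[SecondCountableTopology M] [CompactSpace M] [ChartedSpace (EuclideanSpace ℝ (Fin 4)) M] [IsManifold
(𝓡 4) ∞ M], M ≃ₕ Metric.sphere (0 : EuclideanSpace ℝ (Fin 5)) 1 → ∀ (e : M → Metric.sphere (0 :
EuclideanSpace ℝ (Fin 6)) 1), Manifold.IsSmoothEmbedding (𝓡 4) (𝓡 5) ∞ e → Set.range e =
Function.fixedPoints τ → ∃ g : Literature.Geometry.Lorentzian.PseudoRiemannianMetric (𝓡 5) ∞
(EuclideanSpace ℝ (Fin 5)) (TangentSpace (𝓡 5) : Metric.sphere (0 : EuclideanSpace ℝ (Fin 6)) 1 →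
Type _), g.IsRiemannian ∧ Literature.Geometry.Lorentzian.PseudoRiemannianMetric.IsIsometry g g τ ∧ ∀
cov, g.IsLeviCivita cov → ∀ x (X Y : TangentSpace (𝓡 5) x), 0 ≤ g.curvatureForm cov x X Y Y X`

## Assembly
Pure logic plus two PROVED tree theorems (checked sorry-free in the planner folder,
AssemblyTest.lean): given M (Hausdorff, second
countable, charted, smooth) and e : M ≃ₕ S⁴, M is compact
(Literature.Topology.FourManifolds.compactSpace_of_homotopyEquiv_sphere_four_holds)
and connected (pathConnectedSpace_of_homotopyEquiv + pathConnectedSpace_sphere_four);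
MirrorRealisation gives (τ, e') with
Fix τ = e'(M); MirrorNonnegCurvature gives an invariant sec ≥ 0 metric; ReflectionSoulRigidity gives
M ≅ S⁴, i.e.
HomotopyEquiv.NonemptyDiffeomorphSphere M 4 for the given atlas.

Rationale: WHY THIS LINE. Move the unknown from a MANIFOLD (Σ) to a SYMMETRY of a known manifold: Σ = Fix(τ_Σ)
for a smooth reflection τ_Σ of the standard
S⁵ (Schultz1982; KervaireMilnorAnnals1963 Θ₄-h-cobordism + Smale1962), so SPC4 becomes a
linearisation problem for ℤ/2-actions on
S⁵, attacked by equivariant Riemannian geometry (comparison geometry / soul theorem imported from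
CheegerGromoll1972, FangGrove2016;
scalar-curvature boundary deformation from BarHanke2023, GromovLawson1980). Two corrections to the
card sharpen the line: (i) the
fixed set of a smooth reflection of S⁵ need NOT be simply connected (Kervaire1969: every smooth
homology 4-sphere bounds a
contractible 5-manifold V, and ∂(V×I) ≅ S⁵), so every crux quantifies over mirrors of homotopy
4-spheres only (support
KervaireMirror records the witness); (ii) the mirror is totally geodesic, so every curvature
condition hereditary to totally
geodesic submanifolds (PCO, 2-positive operator, PIC, sec > 0) already descends to Σ and is closed
by 4-dimensional theorems
(Hamilton1986, route PIC) — the one rung where the fifth dimension genuinely buys something is sec ≥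
0, where Σ alone yields
nothing but the symmetric half S⁵/τ is a disc by the soul theorem. Versus route PIC: different
object (metrics on S⁵ compatible
with a symmetry, not metrics on Σ), different engine (soul theorem, no flow, no surgery), and a new
bottom rung (invariant PSC ⇔
PSC with mean-convex boundary on the fake 5-disc, BarHanke2023 Cor. 34). Negatives index: empty.

RANKED CRUXES. #2 ReflectionSoulRigidity (crux) — ENGINE (filed first because it carries the route's
one unproved named fact). If τ is a smooth involution of S⁵ whose fixed-point set is the image of a
smoothly embedded closed connected 4-manifold F, and S⁵ carries a τ-invariant C^∞ Riemannian metric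
with sec ≥ 0 (Rm(X,Y,Y,X) ≥ 0 for every Levi-Civita connection), then F ≅ S⁴. Proof line: Fix τ is
totally geodesic; S⁵ simply connected ⇒ the action is Coxeter with one mirror (Davis, quoted
FangGrove2016 §1); the chamber C = S⁵/τ is compact, sec ≥ 0, with totally geodesic boundary F;
Cheeger–Gromoll soul construction rel ∂C ⇒ S⁵ ≅ S(ν ⊕ ε) equivariantly, F = S(ν), over a soul S
(FangGrove2016 Thm (Open Book), k = 1); a sphere bundle over a positive-dimensional closed S is
never S⁵ (π₁ or H₂/Gysin), so S = pt, ν = ℝ⁵, F = S⁴. No π₁-hypothesis on F is needed. [difficulty: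
L] (why it might fail: Needs the soul theorem for compact sec ≥ 0 manifolds with WEAKLY convex (II =
0) boundary, in print only as Fang–Grove's k = 1 open-book case / Cheeger–Gromoll's construction;
the chamber S⁵/τ (manifold with boundary) is absent from Mathlib, its τ-equivariant boundaryless
rewrite unwritten.) [FangGrove2016, arXiv:1403.5019, CheegerGromoll1972]
#3 MirrorNonnegCurvature (crux) — X itself (card MIRROR-SEC, corrected to mirrors of homotopy
4-spheres): for every smooth involution τ of S⁵ and every closed smooth M ≃ₕ S⁴ smoothly embedded
onto Fix τ, there is a τ-invariant C^∞ Riemannian metric on S⁵ with nonnegative sectional curvature.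
Equivalently: every compact contractible smooth 5-manifold W with simply connected boundary admits
sec ≥ 0 with convex boundary. SPC4 ⇒ X (linear reflection, round metric); X ∧ ReflectionSoulRigidity
∧ MirrorRealisation ⇒ SPC4. [deps: ReflectionSoulRigidity] [difficulty: open-problem] (why it might
fail: SPC4-complete with zero slack: by ReflectionSoulRigidity the mirror of an exotic Σ admits no
invariant sec ≥ 0 metric at all; and no construction of sec ≥ 0 metrics (Cheeger deformation,
Grove–Ziller gluing) starts without a known group action or bundle structure on W.) [FangGrove2016,
CheegerGromoll1972, Schultz1982, KervaireMilnorAnnals1963]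
#4 MirrorScalarCurvature (crux) — BOTTOM RUNG (card MIRROR-RIC weakened to where content starts):
every mirror (τ, M ≃ₕ S⁴ embedded onto Fix τ) of a homotopy 4-sphere carries a τ-invariant
Riemannian metric of positive scalar curvature. By BarHanke2023 Cor. 34 (PSC with H ≥ 0 ⇔ PSC
doubling metric) this is equivalent to: every fake 5-disc W (compact contractible, ∂W simply
connected) carries PSC with mean-convex boundary. Necessary for X (invariant sec ≥ 0, not flat ⇒
invariant PSC by the first conformal eigenfunction); SPC4 ⇒ it; its failure for one mirror refutes
SPC4. [difficulty: M] (why it might fail: W = D⁵ ∪ 2-handles ∪ 3-handles after trading;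
Gromov–Lawson/Gajer give PSC with H > 0 only across handles of codim ≥ 3 (index ≤ 2 here), and from
the Σ side one needs PSC on Σ itself (open: route PIC's PicPscV2); a mean-convex thickening of a
codim-2 spine is not in print.) [BarHanke2023, arXiv:2012.09127, GromovLawson1980,
LawsonMichelsohn1989]
#5 HomotopySphereNonnegCurvature (crux) — INTRINSIC SHADOW of X by heredity: every closed smooth
4-manifold homotopy equivalent to S⁴ carries a Riemannian metric of nonnegative sectional curvature
(the mirror is totally geodesic in any invariant metric, so X ⇒ this by the Gauss equation). Not
known to imply SPC4 (even sec > 0 on a homotopy 4-sphere is not known to force S⁴); a homotopy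
4-sphere without sec ≥ 0 kills X and hence, via ReflectionSoulRigidity, is exotic. [difficulty:
open-problem] (why it might fail: An exotic Σ may carry no sec ≥ 0 metric, yet no obstruction to sec
≥ 0 is known for closed simply connected 4-manifolds with b₂ = 0 (Hopf/Bott-conjecture territory);
positively it needs a metric construction on an unidentified Σ — the same wall as route PIC's
cruxes.) [CheegerGromoll1972, Hamilton1986, BohmWilking2008]
#9 MirrorRealisation (support) — Every closed smooth 4-manifold M ≃ₕ S⁴ is the fixed-point set of a
smooth involution of the standard S⁵: M bounds a compact contractible W⁵ (M is h-cobordant to S⁴,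
KervaireMilnorAnnals1963 Θ₄ = 0 as h-cobordism classes; cap with D⁵), ∂(W × I) is a simply connected
homology 5-sphere bounding the contractible 6-manifold W × I, hence ≅ S⁵ (Smale1962, h-cobordism in
dimension 6), and the swap of the two copies of W is a smooth involution with fixed set exactly M
(Schultz1982). Known; formally heavy (corner smoothing of doubles, tree h-cobordism facts).
[difficulty: L] [Schultz1982, KervaireMilnorAnnals1963, Smale1962]
#9 MirrorRigidityPCO (support) — The card's "equivariant sphere theorem" in its honest (hereditary)
form: if a smooth involution τ of S⁵ with fixed set an embedded closed connected 4-manifold F leaves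
invariant a Riemannian metric with positive curvature operator, then F ≅ S⁴ — because F is totally
geodesic, its curvature operator is the compression of the ambient one (positive), F ⊂ S⁵ is a
closed hypersurface hence orientable, and Hamilton1986 Thm 1.1 (tree fact
hamilton_positiveCurvatureOperator_classification_four) leaves only S⁴. No Ricci flow on S⁵
(BohmWilking2008) is needed: this documents why the route's spine is the sec ≥ 0 rung. [difficulty:
M] [Hamilton1986, BohmWilking2008,
Literature.Geometry.Riemannian.hamilton_positiveCurvatureOperator_classification_four]
#9 KervaireMirror (support) — NEGATIVE CALIBRATION (corrects the card's step 1): there is a smooth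
involution of the standard S⁵ whose fixed-point set is an embedded closed connected 4-manifold with
NONTRIVIAL fundamental group — e.g. F = ∂(D⁵ ∪ two 1-handles ∪ two 2-handles on a balanced
presentation of SL(2,5)), a homology 4-sphere with π₁ = SL(2,5); F bounds a contractible V
(Kervaire1969 Thm 3; or framed surgery as in KervaireMilnorAnnals1963 §§5–6), ∂(V × I) ≅ S⁵
(Smale1962) and the swap fixes exactly F. Hence "every smooth reflection of S⁵ is linear" is false
and every existence crux above is restricted to mirrors of homotopy 4-spheres; such τ admit no
invariant sec ≥ 0 metric (ReflectionSoulRigidity) and are the test objects for any proposed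
Ricci-rung rigidity. [difficulty: L] [Kervaire1969, KervaireMilnorAnnals1963, Smale1962,
Schultz1982]

TWO-LAYER PLAN. Once ReflectionSoulRigidity is staffed: ReflectionSoulRigidity ⇐
MirrorTotallyGeodesic (Fix of an isometric involution is a closed
totally geodesic hypersurface separating S⁵ into two isometric halves) → ChamberSoul (the named
fact: a compact sec ≥ 0 manifold
with totally geodesic boundary is a disc bundle over a soul, Cheeger–Gromoll / FangGrove2016 k = 1)
→ ReflectionSoulRigidity
(topology: sphere bundles over positive-dimensional souls are not S⁵). MirrorScalarCurvature ⇐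
FakeDiscIndexTwo (W has a handle
decomposition of index ≤ 2 — this is item PS "presentation sphere" of route RicciTranscript, to be
SHARED, not re-filed) → MeanConvexThickening (codim ≥ 3 spines have mean-convex PSC thickenings,
Gromov–Lawson–Gajer) →
MirrorScalarCurvature (BarHanke2023 doubling); the complementary case (3-handles unavoidable) is
where it can fail.
MirrorNonnegCurvature is not split before a construction idea exists.

KILL CRITERIA. A homotopy 4-sphere Σ and a mirror τ_Σ with NO invariant PSC metric
(¬MirrorScalarCurvature), or a Σ with no sec ≥ 0 metric
(¬HomotopySphereNonnegCurvature), refutes MirrorNonnegCurvature — and SPC4 with it (both are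
SPC4-consequences): close
`refuted:MirrorNonnegCurvature` and hand the witness to the negative side. ReflectionSoulRigidity
refuted AS STATED (a Lean-level
defect: sign convention of curvatureForm, junk mfderiv in IsIsometry, empty/disconnected F) forces a
restate, not a close — the
mathematics (FangGrove2016) is not in doubt. A proof elsewhere that every homotopy 4-sphere is S⁴
moots the route; a proof of
MirrorScalarCurvature by soft means (expected) is NOT progress on X and only certifies where the
ladder starts to bite.

NOT DECOMPOSED YET. The Ricci rung (invariant Ric > 0 on mirrors: expected neither provable nor
refutable now; its rigidity form "invariant Ric > 0 ⇒
π₁(Fix) = 1" is testable on KervaireMirror objects but peripheral); the flow form X_flow (an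
invariant metric whose Ricci flow on
S⁵ reaches the Böhm–Wilking cone) and the 2-positive / PIC1 rungs (dominated by heredity, see Why
this line); uniqueness of the
contractible coboundary W of Σ (moot unless Σ is exotic); the equivalence "X ⇔ sec ≥ 0 with convex
boundary on fake 5-discs"
(needs manifolds with boundary); equivariant index obstructions (η/ρ-type) to invariant sec ≥ 0 — no
candidate is computable today.

CHEAPEST FALSIFIER. Run first: (1) the Kervaire mirrors — any crux or card statement quantifying
over ALL smooth reflections of S⁵ is refuted by
F = ∂(D⁵ ∪ 1-h ∪ 2-h) with π₁ = SL(2,5) (done here on paper: it killed the card's step-1 converse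
and MIRROR-SEC/MIRROR-EXIST as
literally stated; the filed cruxes restrict to mirrors of homotopy 4-spheres); (2) lookup: is "PSC
with mean-convex boundary on
every compact contractible 5-manifold with simply connected boundary" already a corollary of
Gromov–Lawson–Gajer–Carr (then
MirrorScalarCurvature is `known` and rank 4 goes); (3) sign audit of `curvatureForm` (Lee's
convention, round sphere K = +1 per
ConstantCurvaturePCO.lean) — a flipped sign would make ReflectionSoulRigidity vacuous and X false.

NUMBERS. dim: ambient S⁵ ⊂ ℝ⁶ (𝓡 5), mirror 4-dimensional (𝓡 4); Θ₄ = 0 (h-cobordism classes), Θ₅ =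
0, h-cobordism theorem needs
dimension ≥ 6 for ∂(W × I) ≅ S⁵; PSC surgery/thickening needs codimension ≥ 3 (handles of index ≤ 2
in W⁵); Fang–Grove
open book with k = 1 mirror. Items at open: 8 (4 cruxes, 3 support, 1 assembly).

DEFINITION REQUESTS. None for the filed signatures (PseudoRiemannianMetric, IsIsometry,
IsLeviCivita, curvatureForm, scalarCurvature,
HasPositiveCurvatureOperator, Manifold.IsSmoothEmbedding, Diffeomorph all exist). Cite fact wanted
(filed as kind cite after
open): ChamberSoul / Fang–Grove open-book theorem for one reflection — "a closed simply connected
Riemannian manifold with sec ≥ 0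
and an isometric reflection is equivariantly diffeomorphic to S(ν ⊕ ε) over a soul of the chamber"
(FangGrove2016 Thm (Open
Book), k = 1; CheegerGromoll1972). Later (tenure): 2-positive curvature operator and PIC1 predicates
over PseudoRiemannianMetric
if the flow rung is ever staffed.

Novelty: Searches (2026-08-15): `lit frontier SmoothPoincare4 --since 2020` (30 rows; none on
involutions/curvature on coboundaries);
`lit bridges SmoothPoincare4 --cross any` (30 rows, none relevant); `lit search --source zbmath` ×8:
"reflection groups
non-negative curvature" (1: FangGrove2016), "involutions of spheres fixed point set codimension one"
(Edmonds 2009 tori, Kuroki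
2010), "involution 5-sphere fixed point set homology 4-sphere" (0), "contractible manifold
nonnegative sectional curvature convex
boundary disc" (0), "positive scalar curvature mean convex boundary contractible" (Carlotto–Li
2024), "soul theorem convex boundary
compact nonnegative curvature" (Spindeler 2020, Belegradek–Farrell–Kapovitch 2017), "Kervaire smooth
homology spheres" (Kervaire1969,
Plotnick 1982), "exotic spheres as stationary sets" (Schultz1982); `lit vsearch` "homology 4-sphere
bounds contractible" (Kirby 1989,
Gordon–Kirby 1984 problem list pp. 460–468 read); `lit galaxy search --star all/crabby` (0 useful);
arXiv API rate-limited (4 queries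
failed, logged). Read: FangGrove2016 (arXiv:1403.5019, intro + §3), BarHanke2023 (arXiv:2012.09127,
Cor. 34).
Nearest prior art found: Schultz1982 / KervaireMilnorAnnals1963 (Σ = Fix of the swap on the double
of a contractible coboundary —
the realisation is classical); FangGrove2016 (isometric reflections in sec ≥ 0: the chamber is a
disc bundle over a soul — the
engine is in print); BarHanke2023 Cor. 34 (invariant PSC on a double ⇔ PSC with H ≥ 0 on the hal  [refs: 10.2140/gt.2009.13.1129, 1403.5019, 2012.09127, doi:10.2140/gt.2009.13.1129, FangGrove2016, Kervaire1969, Schultz1982, BarHanke2023, KervaireMilnorAnnals1963, BohmWilking2008]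

Barriers (technique_class: equivariant-linearisation, reflections-of-S5, soul-theorem): - technique_class: equivariant-linearisation, reflections-of-S5, soul-theorem
- Literature.Barriers.SmoothPoincare4.CircleActionBarrierFour: not applicable as an obstruction — it
says S¹-symmetric homotopy 4-spheres are standard (symmetry ON Σ); here the symmetry acts on S⁵ with
Σ as fixed set, and no symmetry of Σ is assumed.
- Literature.Barriers.SmoothPoincare4.ProjectiveRigidityBarrierFour: warns that "linearise the
ℤ/2-action" fails for FREE involutions of S⁴ (fake ℝℙ⁴); acknowledged and sharpened: for reflections
of S⁵ linearisation also fails in general (KervaireMirror), and the route claims it only for mirrors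
of homotopy 4-spheres, where it is equivalent to SPC4; the curvature arguments use the fixed set
essentially and say nothing about free actions.
- Literature.Barriers.SmoothPoincare4.HCobordismBarrierFour: evaded — h-cobordisms enter only in
dimensions 5–6 (Θ₄ = 0 to build W, Smale in dimension 6 to recognise ∂(W × I) ≅ S⁵), never as
"h-cobordant ⇒ diffeomorphic" in dimension 4; the diffeomorphism Σ ≅ S⁴ comes from the normal
exponential map of a point soul.
- Literature.Barriers.SmoothPoincare4.HCobordismInvariantBarrierFour: it does not bite — the route
evaluates no invariant of the h-cobordism class of Σ; the bet is an existence statement for metrics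
on (S⁵, τ_Σ).
- Literature.Barriers.SmoothPoincare4.GaugeSumBarrierFour: not applicable — no sum-stable invariant
is used; (S⁵, τ_Σ) is not a connected-sum datum of Σ.
- Literature.Barriers.SmoothPoincare4.Stable

Novelty grade: new-combination — route-review grade (refuter dc227247; searchd DOWN rc75, so not a full audit). Nearest prior art, verified in print this session: Fang–Grove arXiv:1403.5019 (JDG 2016) p.2 core example + Thm 16 (Open Book, k=1): closed sec ≥ 0 manifold with a separating isometric reflection is equivariantly S(ν⊕ε) o (refuter refuter-rreview-route-KontsevichZagierPe-dc227247-0, 2026-08-15T14:02:51Z; prior: arXiv:1403.5019 (FangGrove2016 Thm 16), Schultz1982, KervaireMilnorAnnals1963, Smale1962, Kervaire1969, arXiv:2012.09127 (BarHanke2023 Cor 34), Hamilton1986)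

History (route lifecycle, newest last):
- 2026-08-22T15:44:38Z · DORMANT — reconciler: no traction for 5.5 d (last activity item-evidence-added at 2026-08-17T04:14:01Z); parked, not closed — `ledger route dormant route-SmoothPoincare4- (operator:999:180186)

sub-problem: SmoothPoincare4 · status: dormant · opened planner-plancard-SmoothPoincare4-SmoothPoinca-b15f6df7-0 2026-08-15T11:41:56Z · rev 1 · ledger route-SmoothPoincare4-ExoticMirrors
GENERATED by the gate from the ledger (D-0016/17). Provers cite these decls: `theorem foo : Summit.SmoothPoincare4.SmoothPoincare4.Theses.ExoticMirrors.<Decl> := …` in Summits/SmoothPoincare4/SmoothPoincare4/Theorems/<Name>.lean.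
-/

namespace Summit.SmoothPoincare4.SmoothPoincare4.Theses.ExoticMirrors

open scoped BigOperators Topology Manifold Classical MeasureTheory ProbabilityTheory Matrix InnerProductSpace ComplexConjugate ContinuousMap ContDiff
open Filter Set Function TopologicalSpace MeasureTheory

attribute [summit_statement] _root_.SmoothPoincare4

open Literature.SPC4

/-- item stmt-SmoothPoincare4-5632 · crux · rank 2 · open · by planner
why it might fail: Needs the soul theorem for compact sec ≥ 0 manifolds with WEAKLY convex (II = 0) boundary, in print only as Fang–Grove's k = 1 open-book case / Cheeger–Gromoll's construction; the chamber S⁵/τ (manifold with boundary) is absent from Mathlib, its τ-equivariant boundaryless rewrite unwritten.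
sources: FangGrove2016, arXiv:1403.5019, CheegerGromoll1972
[crux] ENGINE (filed first because it carries the route's one unproved named fact). If τ is a smooth
involution of S⁵ whose fixed-point set is the image of a smoothly embedded closed connected
4-manifold F, and S⁵ carries a τ-invariant C^∞ Riemannian metric with sec ≥ 0 (Rm(X,Y,Y,X) ≥ 0 for
every Levi-Civita connection), then F ≅ S⁴. Proof line: Fix τ is totally geodesic; S⁵ simply
connected ⇒ the action is Coxeter with one mirror (Davis, quoted FangGrove2016 §1); the chamber C =
S⁵/τ is compact, sec ≥ 0, with totally geodesic boundary F; Cheeger–Gromoll soul construction rel ∂C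
⇒ S⁵ ≅ S(ν ⊕ ε) equivariantly, F = S(ν), over a soul S (FangGrove2016 Thm (Open Book), k = 1); a
sphere bundle over a positive-dimensional closed S is never S⁵ (π₁ or H₂/Gysin), so S = pt, ν = ℝ⁵,
F = S⁴. No π₁-hypothesis on F is needed. [difficulty: L] -/
@[route_item "route-SmoothPoincare4-ExoticMirrors", crux]
def ReflectionSoulRigidity : Prop :=
  ∀ (τ : (Metric.sphere (0 : EuclideanSpace ℝ (Fin 6)) 1) ≃ₘ⟮𝓡 5, 𝓡 5⟯ (Metric.sphere (0 : EuclideanSpace ℝ (Fin 6)) 1)), (∀ x, τ (τ x) = x) → ∀ (F : Type) [TopologicalSpace F] [T2Space F] [SecondCountableTopology F] [CompactSpace F] [ConnectedSpace F] [ChartedSpace (EuclideanSpace ℝ (Fin 4)) F] [IsManifold (𝓡 4) ∞ F] (e : F → Metric.sphere (0 : EuclideanSpace ℝ (Fin 6)) 1), Manifold.IsSmoothEmbedding (𝓡 4) (𝓡 5) ∞ e → Set.range e = Function.fixedPoints τ → (∃ g : Literature.Geometry.Lorentzian.PseudoRiemannianMetric (𝓡 5) ∞ (EuclideanSpace ℝ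 (Fin 5)) (TangentSpace (𝓡 5) : Metric.sphere (0 : EuclideanSpace ℝ (Fin 6)) 1 → Type _), g.IsRiemannian ∧ Literature.Geometry.Lorentzian.PseudoRiemannianMetric.IsIsometry g g τ ∧ ∀ cov, g.IsLeviCivita cov → ∀ x (X Y : TangentSpace (𝓡 5) x), 0 ≤ g.curvatureForm cov x X Y Y X) → Nonempty (F ≃ₘ⟮𝓡 4, 𝓡 4⟯ Metric.sphere (0 : EuclideanSpace ℝ (Fin 5)) 1)

/-- item stmt-SmoothPoincare4-5633 · crux · rank 3 · open · by planner
why it might fail: SPC4-complete with zero slack: by ReflectionSoulRigidity the mirror of an exotic Σ admits no invariant sec ≥ 0 metric at all; and no construction of sec ≥ 0 metrics (Cheeger deformation, Grove–Ziller gluing) starts without a known group action or bundle structure on W.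
sources: FangGrove2016, CheegerGromoll1972, Schultz1982, KervaireMilnorAnnals1963
[crux] X itself (card MIRROR-SEC, corrected to mirrors of homotopy 4-spheres): for every smooth
involution τ of S⁵ and every closed smooth M ≃ₕ S⁴ smoothly embedded onto Fix τ, there is a
τ-invariant C^∞ Riemannian metric on S⁵ with nonnegative sectional curvature. Equivalently: every
compact contractible smooth 5-manifold W with simply connected boundary admits sec ≥ 0 with convex
boundary. SPC4 ⇒ X (linear reflection, round metric); X ∧ ReflectionSoulRigidity ∧ MirrorRealisation
⇒ SPC4. [deps: ReflectionSoulRigidity] [difficulty: open-problem] -/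
@[route_item "route-SmoothPoincare4-ExoticMirrors", crux]
def MirrorNonnegCurvature : Prop :=
  ∀ (τ : (Metric.sphere (0 : EuclideanSpace ℝ (Fin 6)) 1) ≃ₘ⟮𝓡 5, 𝓡 5⟯ (Metric.sphere (0 : EuclideanSpace ℝ (Fin 6)) 1)), (∀ x, τ (τ x) = x) → ∀ (M : Type) [TopologicalSpace M] [T2Space M] [SecondCountableTopology M] [CompactSpace M] [ChartedSpace (EuclideanSpace ℝ (Fin 4)) M] [IsManifold (𝓡 4) ∞ M], M ≃ₕ Metric.sphere (0 : EuclideanSpace ℝ (Fin 5)) 1 → ∀ (e : M → Metric.sphere (0 : EuclideanSpace ℝ (Fin 6)) 1), Manifold.IsSmoothEmbedding (𝓡 4) (𝓡 5) ∞ e → Set.range e = Function.fixedPoints τ → ∃ g : Literature.Geometry.Lorentzian.PseudoRiemannianMetric (𝓡 5) ∞ (EuclideanSpace ℝ (Fin 5)) (TangentSpace (𝓡 5) : Metric.sphere (0 : EuclideanSpace ℝ (Fin 6)) 1 → Type _), g.IsRiemannian ∧ Literature.Geometry.Lorentzian.PseudoRiemannianMetric.IsIsometry g g τ ∧ ∀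 cov, g.IsLeviCivita cov → ∀ x (X Y : TangentSpace (𝓡 5) x), 0 ≤ g.curvatureForm cov x X Y Y X

/-- item stmt-SmoothPoincare4-5634 · crux · rank 4 · open · by planner
why it might fail: W = D⁵ ∪ 2-handles ∪ 3-handles after trading; Gromov–Lawson/Gajer give PSC with H > 0 only across handles of codim ≥ 3 (index ≤ 2 here), and from the Σ side one needs PSC on Σ itself (open: route PIC's PicPscV2); a mean-convex thickening of a codim-2 spine is not in print.
sources: BarHanke2023, arXiv:2012.09127, GromovLawson1980, LawsonMichelsohn1989
[crux] BOTTOM RUNG (card MIRROR-RIC weakened to where content starts): every mirror (τ, M ≃ₕ S⁴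
embedded onto Fix τ) of a homotopy 4-sphere carries a τ-invariant Riemannian metric of positive
scalar curvature. By BarHanke2023 Cor. 34 (PSC with H ≥ 0 ⇔ PSC doubling metric) this is equivalent
to: every fake 5-disc W (compact contractible, ∂W simply connected) carries PSC with mean-convex
boundary. Necessary for X (invariant sec ≥ 0, not flat ⇒ invariant PSC by the first conformal
eigenfunction); SPC4 ⇒ it; its failure for one mirror refutes SPC4. [difficulty: M] -/
@[route_item "route-SmoothPoincare4-ExoticMirrors"]
def MirrorScalarCurvature : Prop :=
  ∀ (τ : (Metric.sphere (0 : EuclideanSpace ℝ (Fin 6)) 1) ≃ₘ⟮𝓡 5, 𝓡 5⟯ (Metric.sphere (0 : EuclideanSpace ℝ (Fin 6)) 1)), (∀ x, τ (τ x) = x) → ∀ (M : Type) [TopologicalSpace M] [T2Space M] [SecondCountableTopology M] [CompactSpace M] [ChartedSpace (EuclideanSpace ℝ (Fin 4)) M] [IsManifold (𝓡 4) ∞ M], M ≃ₕ Metric.sphere (0 : EuclideanSpace ℝ (Fin 5)) 1 → ∀ (e : M → Metric.sphere (0 : EuclideanSpace ℝ (Fin 6)) 1), Manifold.IsSmoothEmbedding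 (𝓡 4) (𝓡 5) ∞ e → Set.range e = Function.fixedPoints τ → ∃ g : Literature.Geometry.Lorentzian.PseudoRiemannianMetric (𝓡 5) ∞ (EuclideanSpace ℝ (Fin 5)) (TangentSpace (𝓡 5) : Metric.sphere (0 : EuclideanSpace ℝ (Fin 6)) 1 → Type _), ∃ _ : g.HasLeviCivita, g.IsRiemannian ∧ Literature.Geometry.Lorentzian.PseudoRiemannianMetric.IsIsometry g g τ ∧ ∀ x, 0 < g.scalarCurvature x

/-- item stmt-SmoothPoincare4-5635 · crux · rank 5 · open · by planner
why it might fail: An exotic Σ may carry no sec ≥ 0 metric, yet no obstruction to sec ≥ 0 is known for closed simply connected 4-manifolds with b₂ = 0 (Hopf/Bott-conjecture territory); positively it needs a metric construction on an unidentified Σ — the same wall as route PIC's cruxes.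
sources: CheegerGromoll1972, Hamilton1986, BohmWilking2008
[crux] INTRINSIC SHADOW of X by heredity: every closed smooth 4-manifold homotopy equivalent to S⁴
carries a Riemannian metric of nonnegative sectional curvature (the mirror is totally geodesic in
any invariant metric, so X ⇒ this by the Gauss equation). Not known to imply SPC4 (even sec > 0 on a
homotopy 4-sphere is not known to force S⁴); a homotopy 4-sphere without sec ≥ 0 kills X and hence,
via ReflectionSoulRigidity, is exotic. [difficulty: open-problem] -/
@[route_item "route-SmoothPoincare4-ExoticMirrors"]
def HomotopySphereNonnegCurvature : Prop :=
  ∀ (M : Type) [TopologicalSpace M] [T2Space M] [SecondCountableTopology M] [CompactSpace M] [ChartedSpace (EuclideanSpace ℝ (Fin 4)) M] [IsManifold (𝓡 4) ∞ M], M ≃ₕ Metric.sphere (0 : EuclideanSpace ℝ (Fin 5)) 1 → ∃ g : Literature.Geometry.Lorentzian.PseudoRiemannianMetric (𝓡 4) ∞ (EuclideanSpace ℝ (Fin 4)) (TangentSpace (𝓡 4) : M → Type _), g.IsRiemannian ∧ ∀ cov, g.IsLeviCivita cov → ∀ x (X Y : TangentSpace (𝓡 4) x), 0 ≤ g.curvatureForm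 cov x X Y Y X

/-- item stmt-SmoothPoincare4-5636 · support · rank 9 · open · by planner
sources: Schultz1982, KervaireMilnorAnnals1963, Smale1962
[support] Every closed smooth 4-manifold M ≃ₕ S⁴ is the fixed-point set of a smooth involution of
the standard S⁵: M bounds a compact contractible W⁵ (M is h-cobordant to S⁴,
KervaireMilnorAnnals1963 Θ₄ = 0 as h-cobordism classes; cap with D⁵), ∂(W × I) is a simply connected
homology 5-sphere bounding the contractible 6-manifold W × I, hence ≅ S⁵ (Smale1962, h-cobordism in
dimension 6), and the swap of the two copies of W is a smooth involution with fixed set exactly M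
(Schultz1982). Known; formally heavy (corner smoothing of doubles, tree h-cobordism facts).
[difficulty: L] -/
@[route_item "route-SmoothPoincare4-ExoticMirrors", crux]
def MirrorRealisation : Prop :=
  ∀ (M : Type) [TopologicalSpace M] [T2Space M] [SecondCountableTopology M] [CompactSpace M] [ChartedSpace (EuclideanSpace ℝ (Fin 4)) M] [IsManifold (𝓡 4) ∞ M], M ≃ₕ Metric.sphere (0 : EuclideanSpace ℝ (Fin 5)) 1 → ∃ τ : (Metric.sphere (0 : EuclideanSpace ℝ (Fin 6)) 1) ≃ₘ⟮𝓡 5, 𝓡 5⟯ (Metric.sphere (0 : EuclideanSpace ℝ (Fin 6)) 1), (∀ x, τ (τ x) = x) ∧ ∃ e : M → Metric.sphere (0 : EuclideanSpace ℝ (Fin 6)) 1, Manifold.IsSmoothEmbedding (𝓡 4) (𝓡 5) ∞ e ∧ Set.range e = Function.fixedPoints τ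

/-- item stmt-SmoothPoincare4-5637 · support · rank 9 · open · by planner
sources: Hamilton1986, BohmWilking2008, Literature.Geometry.Riemannian.hamilton_positiveCurvatureOperator_classification_four
[support] The card's "equivariant sphere theorem" in its honest (hereditary) form: if a smooth
involution τ of S⁵ with fixed set an embedded closed connected 4-manifold F leaves invariant a
Riemannian metric with positive curvature operator, then F ≅ S⁴ — because F is totally geodesic, its
curvature operator is the compression of the ambient one (positive), F ⊂ S⁵ is a closed hypersurface
hence orientable, and Hamilton1986 Thm 1.1 (tree fact
hamilton_positiveCurvatureOperator_classification_four) leaves only S⁴. No Ricci flow on S⁵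
(BohmWilking2008) is needed: this documents why the route's spine is the sec ≥ 0 rung. [difficulty:
M] -/
@[route_item "route-SmoothPoincare4-ExoticMirrors"]
def MirrorRigidityPCO : Prop :=
  ∀ (τ : (Metric.sphere (0 : EuclideanSpace ℝ (Fin 6)) 1) ≃ₘ⟮𝓡 5, 𝓡 5⟯ (Metric.sphere (0 : EuclideanSpace ℝ (Fin 6)) 1)), (∀ x, τ (τ x) = x) → ∀ (F : Type) [TopologicalSpace F] [T2Space F] [SecondCountableTopology F] [CompactSpace F] [ConnectedSpace F] [ChartedSpace (EuclideanSpace ℝ (Fin 4)) F] [IsManifold (𝓡 4) ∞ F] (e : F → Metric.sphere (0 : EuclideanSpace ℝ (Fin 6)) 1), Manifold.IsSmoothEmbedding (𝓡 4) (𝓡 5) ∞ e → Set.range e = Function.fixedPoints τ → (∃ g : Literature.Geometry.Lorentzian.PseudoRiemannianMetric (𝓡 5) ∞ (EuclideanSpace ℝ (Fin 5)) (TangentSpace (𝓡 5) : Metric.sphere (0 : EuclideanSpace ℝ (Fin 6)) 1 → Type _), g.IsRiemannian ∧ Literature.Geometry.Lorentzian.PseudoRiemannianMetric.IsIsometry g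 g τ ∧ g.HasPositiveCurvatureOperator) → Nonempty (F ≃ₘ⟮𝓡 4, 𝓡 4⟯ Metric.sphere (0 : EuclideanSpace ℝ (Fin 5)) 1)

/-- item stmt-SmoothPoincare4-5638 · support · rank 9 · open · by planner
sources: Kervaire1969, KervaireMilnorAnnals1963, Smale1962, Schultz1982
[support] NEGATIVE CALIBRATION (corrects the card's step 1): there is a smooth involution of the
standard S⁵ whose fixed-point set is an embedded closed connected 4-manifold with NONTRIVIAL
fundamental group — e.g. F = ∂(D⁵ ∪ two 1-handles ∪ two 2-handles on a balanced presentation of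
SL(2,5)), a homology 4-sphere with π₁ = SL(2,5); F bounds a contractible V (Kervaire1969 Thm 3; or
framed surgery as in KervaireMilnorAnnals1963 §§5–6), ∂(V × I) ≅ S⁵ (Smale1962) and the swap fixes
exactly F. Hence "every smooth reflection of S⁵ is linear" is false and every existence crux above
is restricted to mirrors of homotopy 4-spheres; such τ admit no invariant sec ≥ 0 metric
(ReflectionSoulRigidity) and are the test objects for any proposed Ricci-rung rigidity. [difficulty:
L] -/
@[route_item "route-SmoothPoincare4-ExoticMirrors"]
def KervaireMirror : Prop :=
  ∃ τ : (Metric.sphere (0 : EuclideanSpace ℝ (Fin 6)) 1) ≃ₘ⟮𝓡 5, 𝓡 5⟯ (Metric.sphere (0 : EuclideanSpace ℝ (Fin 6)) 1), (∀ x, τ (τ x) = x) ∧ ∃ (F : Type) (_ : TopologicalSpace F) (_ : T2Space F) (_ : SecondCountableTopology F) (_ : CompactSpace F) (_ : ConnectedSpace F) (_ : ChartedSpace (EuclideanSpace ℝ (Fin 4)) F) (_ : IsManifold (𝓡 4) ∞ F) (e : F → Metric.sphere (0 : EuclideanSpace ℝ (Fin 6)) 1), Manifold.IsSmoothEmbedding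 (𝓡 4) (𝓡 5) ∞ e ∧ Set.range e = Function.fixedPoints τ ∧ ¬ SimplyConnectedSpace F

/-- item stmt-SmoothPoincare4-5639 · assembly · rank 1 · open · by planner
sources: Schultz1982, FangGrove2016, KervaireMilnorAnnals1963
[assembly] MirrorRealisation → MirrorNonnegCurvature → ReflectionSoulRigidity → SmoothPoincare4. -/
@[route_item "route-SmoothPoincare4-ExoticMirrors"]
def Assembly : Prop :=
  MirrorRealisation → MirrorNonnegCurvature → ReflectionSoulRigidity → SmoothPoincare4

/-! D-0027 §2.1 — DECIDING THEOREM (planner-authored via `route open/edit --closes-file`; by planner-rbadge-SmoothPoincare4-ExoticMirrors-0e19c3b3-g4-0 2026-08-15T16:11:02Z):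
its hypotheses are this route's items and its conclusion the sub-problem Statement (glue_lint), and it elaborates with this file. -/

@[closes "route-SmoothPoincare4-ExoticMirrors"] theorem closes (hR : MirrorRealisation) (hX : MirrorNonnegCurvature)
    (hS : ReflectionSoulRigidity) : _root_.SmoothPoincare4 := by
  unfold _root_.SmoothPoincare4 Literature.SPC4.SmoothPoincareConjectureFour
    ContinuousMap.HomotopyEquiv.NonemptyDiffeomorphSphere
  intro M _ _ _ _ _ e
  haveI : CompactSpace M :=
    Literature.Topology.FourManifolds.compactSpace_of_homotopyEquiv_sphere_four_holds M e
  haveI : PathConnectedSpace (Metric.sphere (0 : EuclideanSpace ℝ (Fin 5)) 1) :=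
    Literature.Topology.FourManifolds.pathConnectedSpace_sphere_four
  haveI : PathConnectedSpace M :=
    Literature.Topology.FourManifolds.pathConnectedSpace_of_homotopyEquiv e
  obtain ⟨τ, hτ, e', he', hfix⟩ := hR M e
  exact hS τ hτ M e' he' hfix (hX τ hτ M e e' he' hfix)

end Summit.SmoothPoincare4.SmoothPoincare4.Theses.ExoticMirrors
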